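import Mathlib.MeasureTheory.Function.ConditionalExpectation.Real
import Mathlib.MeasureTheory.Function.ConditionalExpectation.PullOut
import Mathlib.MeasureTheory.Integral.MeanInequalities
import Literature.MathematicalPhysics.QuantumFieldTheory.LatticeGaugeProofs
import Literature.MathematicalPhysics.QuantumLattice.ContinuumLimitLGT
import Literature.Probability.LatticeModels.ONModelSpecification
import HarnessLib

/-!
# Separated cubes on the lattice torus and telescoping of conditional means

Elementary inputs of the "conditional-mean telescoping" bound for lattice gauge theory on the
discrete torus `(ℤ/Lℤ)⁴`, `L = 2S+1` (the torus below `ℤ⁴` through `torusEdge`, `torusLift` of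
`LatticeGaugeDLR.lean`): for plaquettes `p₁, …, pₙ` whose base points are pairwise far apart,
`|E ∏ₖ δpₖ| ≤ ∏ₖ ‖E[δpₖ | links outside a cube around pₖ]‖_{Lⁿ}` as soon as each conditional
mean has a LOCAL version (Markov property).  Three groups of facts, all standard:

* **Geometry.** The cube `Q_R(c)` is the set of links of `ℤ⁴` with both endpoints in the
  `ℓ^∞`-ball of radius `R` about `c ∈ ℤ⁴`; it is monotone in `R` (`linkCube_mono`), and two cubes
  `Q_{R+1}(a)`, `Q_R(b)` have DISJOINT images on the torus of side `2S+1` when `a, b` differ in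
  some coordinate by more than `2R+1` and at most `S`, `4R+4 < 2S+1`
  (`image_torusEdge_linkCube_succ_subset_compl`; periodic boundary conditions as in Seiler,
  LNP 159, Ch. 2).
* **The centred plaquette** `Re tr ρ(U_p) − a` read through the periodic lift depends only on
  the links in the image of `Q_1(c)` (`dependsOn_plaquetteObs_torusLift_sub`), hence is
  measurable for the corresponding cylinder σ-algebra (Georgii 2011, §1.2), and is bounded by
  `2N` when `a` is its mean and `ρ` is unitary (Chatterjee, arXiv:1803.01950, §2–3).
* **Abstract probability.** Generalised Hölder for a finite real product in `toReal` form
  (`abs_integral_prod_le_prod_toReal_eLpNorm`, Mathlib `ENNReal.lintegral_prod_norm_pow_le`);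
  monotonicity of `‖E[X | 𝓕]‖ₚ` along `𝓕₁ ≤ 𝓕₂` (`toReal_eLpNorm_condExp_mono`, tower property
  and Jensen, Mathlib `eLpNorm_condExp_le_eLpNorm`); and the TELESCOPING IDENTITY
  `∫ ∏ₖ Xₖ = ∫ ∏ₖ gₖ` when `gₖ` is a version of `E[Xₖ | 𝓔ₖ]` measurable, like `Xₖ`, for a
  σ-algebra contained in every other `𝓔ₗ` (`integral_prod_eq_integral_prod_of_ae_eq_condExp`;
  tower property and pull-out, Williams 1991, §9.7).

Nothing here is specific to Wilson's action: the measure is arbitrary (finite, resp.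
probability).  Not here: the Markov property itself (see `TorusWilsonGibbs.lean`).
-/

noncomputable section

open MeasureTheory Filter
open scoped ENNReal
open Literature.MathematicalPhysics.QuantumFieldTheory

namespace Literature.MathematicalPhysics.QuantumLattice

/-! ### Abstract probability -/

section Abstract

variable {Ω : Type*} {m0 : MeasurableSpace Ω} {μ : Measure Ω}

/-- **Generalised Hölder inequality for a finite real product**, `toReal` form: for `n ≠ 0`
real functions `f₁, …, fₙ ∈ Lⁿ(μ)`, `|∫ ∏ₖ fₖ dμ| ≤ ∏ₖ ‖fₖ‖_{Lⁿ(μ)}` (Hölder with exponents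
`1/n + ⋯ + 1/n = 1`; Mathlib `ENNReal.lintegral_prod_norm_pow_le`). [folklore] -/
theorem abs_integral_prod_le_prod_toReal_eLpNorm {n : ℕ} (hn : n ≠ 0) (f : Fin n → Ω → ℝ)
    (hf : ∀ k, MemLp (f k) (n : ℝ≥0∞) μ) :
    |∫ ω, ∏ k, f k ω ∂μ| ≤ ∏ k, (eLpNorm (f k) (n : ℝ≥0∞) μ).toReal := by
  have hn' : (n : ℝ) ≠ 0 := Nat.cast_ne_zero.2 hn
  have hp0 : (n : ℝ≥0∞) ≠ 0 := Nat.cast_ne_zero.2 hn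
  have hpt : (n : ℝ≥0∞) ≠ ∞ := ENNReal.natCast_ne_top n
  have h1 : |∫ ω, ∏ k, f k ω ∂μ| ≤ (∫⁻ ω, ∏ k, ‖f k ω‖ₑ ∂μ).toReal := by
    rw [← Real.norm_eq_abs]
    refine (norm_integral_le_lintegral_norm _).trans (le_of_eq ?_)
    congr 1
    refine lintegral_congr fun ω => ?_
    rw [ofReal_norm]
    simp [enorm, nnnorm_prod]
  have h2 : ∫⁻ ω, ∏ k, ‖f k ω‖ₑ ∂μ ≤ ∏ k, eLpNorm (f k) (n : ℝ≥0∞) μ := by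
    have key := ENNReal.lintegral_prod_norm_pow_le (μ := μ) Finset.univ
      (f := fun k ω => ‖f k ω‖ₑ ^ (n : ℝ))
      (fun k _ => (hf k).aestronglyMeasurable.enorm.pow_const _)
      (p := fun _ => (n : ℝ)⁻¹) (by simp [hn']) (fun _ _ => by positivity)
    simp only [ENNReal.rpow_rpow_inv hn'] at key
    refine key.trans (le_of_eq (Finset.prod_congr rfl fun k _ => ?_))
    rw [eLpNorm_eq_lintegral_rpow_enorm_toReal hp0 hpt, ENNReal.toReal_natCast, one_div]
  have h3 : ∏ k, eLpNorm (f k) (n : ℝ≥0∞) μ ≠ ∞ :=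
    ENNReal.prod_ne_top fun k _ => (hf k).eLpNorm_ne_top
  calc |∫ ω, ∏ k, f k ω ∂μ| ≤ (∫⁻ ω, ∏ k, ‖f k ω‖ₑ ∂μ).toReal := h1
    _ ≤ (∏ k, eLpNorm (f k) (n : ℝ≥0∞) μ).toReal := ENNReal.toReal_mono h3 h2
    _ = ∏ k, (eLpNorm (f k) (n : ℝ≥0∞) μ).toReal := ENNReal.toReal_prod _ _

/-- **Monotonicity of conditional `Lᵖ` norms** (`1 ≤ p`, finite measure, `X ∈ Lᵖ`): along
`m₁ ≤ m₂`, `‖E[X | m₁]‖ₚ ≤ ‖E[X | m₂]‖ₚ`, in `toReal` form — tower property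
`E[X | m₁] = E[E[X | m₂] | m₁]` and contractivity of conditional expectation in `Lᵖ`
(conditional Jensen; Williams 1991, §9.7–9.8; Mathlib `eLpNorm_condExp_le_eLpNorm`).
[folklore] -/
theorem toReal_eLpNorm_condExp_mono [IsFiniteMeasure μ] {m₁ m₂ : MeasurableSpace Ω}
    (hm : m₁ ≤ m₂) (hm₂ : m₂ ≤ m0) {X : Ω → ℝ} {p : ℝ≥0∞} (hX : MemLp X p μ) (hp : 1 ≤ p) :
    (eLpNorm (μ[X | m₁]) p μ).toReal ≤ (eLpNorm (μ[X | m₂]) p μ).toReal := by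
  have htower : μ[X | m₁] =ᵐ[μ] μ[μ[X | m₂] | m₁] := (condExp_condExp_of_le hm hm₂).symm
  have hle : eLpNorm (μ[X | m₁]) p μ ≤ eLpNorm (μ[X | m₂]) p μ := by
    rw [eLpNorm_congr_ae htower]
    exact eLpNorm_condExp_le_eLpNorm _ hp
  have hfin : eLpNorm (μ[X | m₂]) p μ ≠ ∞ :=
    ((eLpNorm_condExp_le_eLpNorm _ hp).trans_lt hX.eLpNorm_lt_top).ne
  exact ENNReal.toReal_mono hfin hle

/-- **Telescoping of conditional means.** On a finite measure space let `X₁, …, Xₙ` be bounded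
and let `gₖ` be a version of `E[Xₖ | 𝓔ₖ]`, where `Xₖ` and `gₖ` are both measurable for a
σ-algebra `𝓛ₖ` contained in every OTHER `𝓔ₗ`, `l ≠ k`.  Then `∫ ∏ₖ Xₖ = ∫ ∏ₖ gₖ`: replace the
factors one at a time — at step `k` the product of the other factors is `𝓔ₖ`-measurable and
bounded, so `∫ (∏_{l≠k} ·) Xₖ = ∫ E[(∏_{l≠k} ·) Xₖ | 𝓔ₖ] = ∫ (∏_{l≠k} ·) E[Xₖ | 𝓔ₖ]` (tower property
and pull-out; Williams 1991, §9.7 (i), (j)). [folklore] -/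
theorem integral_prod_eq_integral_prod_of_ae_eq_condExp [IsFiniteMeasure μ] {n : ℕ}
    (mloc mext : Fin n → MeasurableSpace Ω) (hloc : ∀ k, mloc k ≤ m0)
    (hext : ∀ k, mext k ≤ m0) (hsep : ∀ k l, k ≠ l → mloc k ≤ mext l)
    {X g : Fin n → Ω → ℝ} {B : ℝ}
    (hXm : ∀ k, StronglyMeasurable[mloc k] (X k)) (hXb : ∀ k ω, |X k ω| ≤ B)
    (hgm : ∀ k, StronglyMeasurable[mloc k] (g k)) (hg : ∀ k, g k =ᵐ[μ] μ[X k | mext k]) :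
    ∫ ω, ∏ k, X k ω ∂μ = ∫ ω, ∏ k, g k ω ∂μ := by
  -- a.e. bound on the versions
  have hgb : ∀ k, ∀ᵐ ω ∂μ, |g k ω| ≤ B := fun k => by
    filter_upwards [hg k, ae_bdd_abs_condExp_of_ae_bdd_abs (μ := μ) (m := mext k)
      (Eventually.of_forall (hXb k))] with ω h1 h2
    rw [h1]; exact h2
  -- interpolating families: the first `m` factors replaced
  set Y : ℕ → Fin n → Ω → ℝ := fun m k => if k.val < m then g k else X k with hY
  have hYm : ∀ m k, StronglyMeasurable[mloc k] (Y m k) := fun m k => by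
    by_cases h : k.val < m
    · simp only [hY, h, if_true]; exact hgm k
    · simp only [hY, h, if_false]; exact hXm k
  have hYb : ∀ m k, ∀ᵐ ω ∂μ, |Y m k ω| ≤ B := fun m k => by
    by_cases h : k.val < m
    · simp only [hY, h, if_true]; exact hgb k
    · simp only [hY, h, if_false]; exact Eventually.of_forall (hXb k)
  have hYall : ∀ m, ∀ᵐ ω ∂μ, ∀ k, |Y m k ω| ≤ B := fun m => eventually_all.2 (hYb m)
  -- partial products are a.e. bounded, hence integrable
  have hbound : ∀ m (s : Finset (Fin n)), ∀ᵐ ω ∂μ, ‖∏ k ∈ s, Y m k ω‖ ≤ B ^ s.card := by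
    intro m s
    filter_upwards [hYall m] with ω hω
    rw [Real.norm_eq_abs, Finset.abs_prod, ← Finset.prod_const]
    exact Finset.prod_le_prod (fun k _ => abs_nonneg _) fun k _ => hω k
  have hint : ∀ m (s : Finset (Fin n)), Integrable (fun ω => ∏ k ∈ s, Y m k ω) μ := fun m s =>
    Integrable.of_bound (Finset.aestronglyMeasurable_fun_prod s fun k _ =>
      ((hYm m k).mono (hloc k)).aestronglyMeasurable) (B ^ s.card) (hbound m s)
  -- one step of the telescope
  have step : ∀ m, m < n → ∫ ω, ∏ k, Y m k ω ∂μ = ∫ ω, ∏ k, Y (m + 1) k ω ∂μ := by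
    intro m hm
    set κ : Fin n := ⟨m, hm⟩ with hκ
    set P : Ω → ℝ := fun ω => ∏ k ∈ Finset.univ.erase κ, Y m k ω with hP
    have hYκ : Y m κ = X κ := by simp [hY, κ]
    have hYκ' : Y (m + 1) κ = g κ := by simp [hY, κ]
    have hPeq : ∀ ω, ∏ k ∈ Finset.univ.erase κ, Y (m + 1) k ω = P ω := by
      intro ω
      refine Finset.prod_congr rfl fun k hk => ?_
      have hk' : k.val ≠ m := fun h => Finset.ne_of_mem_erase hk (Fin.ext h)
      simp only [hY, Nat.lt_succ_iff_lt_or_eq, hk', or_false]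
    have h1 : (fun ω => ∏ k, Y m k ω) = P * X κ := by
      funext ω
      rw [← Finset.prod_erase_mul _ _ (Finset.mem_univ κ), hYκ]; rfl
    have h2 : (fun ω => ∏ k, Y (m + 1) k ω) = P * g κ := by
      funext ω
      rw [← Finset.prod_erase_mul _ _ (Finset.mem_univ κ), hYκ', hPeq]; rfl
    have hPm : StronglyMeasurable[mext κ] P :=
      Finset.stronglyMeasurable_fun_prod (m := mext κ) _ fun k hk =>
        (hYm m k).mono (hsep k κ (Finset.ne_of_mem_erase hk))
    have hXint : Integrable (X κ) μ := by simpa [hYκ] using hint m {κ}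
    rw [h1, h2]
    calc ∫ ω, (P * X κ) ω ∂μ = ∫ ω, (μ[P * X κ | mext κ]) ω ∂μ := (integral_condExp (hext κ)).symm
      _ = ∫ ω, (P * μ[X κ | mext κ]) ω ∂μ :=
          integral_congr_ae (condExp_stronglyMeasurable_mul_of_bound (hext κ) hPm hXint _
            (hbound m _))
      _ = ∫ ω, (P * g κ) ω ∂μ := by
          refine integral_congr_ae ?_
          filter_upwards [hg κ] with ω hω
          simp [hω]
  -- iterate
  have iter : ∀ m, m ≤ n → ∫ ω, ∏ k, Y m k ω ∂μ = ∫ ω, ∏ k, Y 0 k ω ∂μ := by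
    intro m hm
    induction m with
    | zero => rfl
    | succ m ih => rw [← step m hm, ih (Nat.le_of_succ_le hm)]
  have hY0 : ∀ k, Y 0 k = X k := fun k => by simp [hY]
  have hYn : ∀ k, Y n k = g k := fun k => by simp [hY, k.isLt]
  have := iter n le_rfl
  simpa only [hY0, hYn] using this.symm

end Abstract

/-! ### Lattice geometry: cubes of links and their images on the torus -/

section Geometry

/-- The **link cube** `Q_R(c) = {e = (b, k) ∈ ℤ⁴ × Fin 4 | ‖b − c‖_∞ ≤ R, ‖b + e_k − c‖_∞ ≤ R}`
(links of `ℤ⁴` with both endpoints in the `ℓ^∞`-ball of radius `R` about `c`) is monotone in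
the radius `R`. [folklore] -/
theorem linkCube_mono {R R' : ℕ} (h : R' ≤ R) (c : Literature.Probability.LatticeModels.Site 4) :
    {e : ZdEdge 4 |
        (∀ ν, |e.1 ν - c ν| ≤ (R' : ℤ)) ∧
        ∀ ν, |e.1 ν + (if ν = e.2 then 1 else 0) - c ν| ≤ (R' : ℤ)} ⊆
      {e : ZdEdge 4 |
        (∀ ν, |e.1 ν - c ν| ≤ (R : ℤ)) ∧
        ∀ ν, |e.1 ν + (if ν = e.2 then 1 else 0) - c ν| ≤ (R : ℤ)} := by
  rintro e ⟨h1, h2⟩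
  have hc : (R' : ℤ) ≤ R := by exact_mod_cast h
  exact ⟨fun ν => (h1 ν).trans hc, fun ν => (h2 ν).trans hc⟩

/-- **Cube separation on the torus** (periodic boundary conditions, Seiler LNP 159 Ch. 2): if
two base points `a, b ∈ ℤ⁴` differ in some coordinate by more than `2R+1` and at most `S`, and
`4R+4 < 2S+1`, then on the torus of side `2S+1` the image under `torusEdge` of the link cube
`Q_{R+1}(a)` misses the image of `Q_R(b)`: in the separating coordinate the base points of two
such links differ by a NONZERO integer of modulus less than `2S+1`, so their reductions mod
`2S+1` differ. [folklore] -/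
theorem image_torusEdge_linkCube_succ_subset_compl {S R : ℕ}
    {a b : Literature.Probability.LatticeModels.Site 4} (hRS : 4 * R + 4 < 2 * S + 1)
    (hsep : ∃ μ : Fin 4, (2 * R + 1 : ℤ) < |a μ - b μ| ∧ |a μ - b μ| ≤ S) :
    torusEdge (2 * S + 1) ''
        {e : ZdEdge 4 |
          (∀ ν, |e.1 ν - a ν| ≤ ((R + 1 : ℕ) : ℤ)) ∧
          ∀ ν, |e.1 ν + (if ν = e.2 then 1 else 0) - a ν| ≤ ((R + 1 : ℕ) : ℤ)} ⊆
      (torusEdge (2 * S + 1) ''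
        {e : ZdEdge 4 |
          (∀ ν, |e.1 ν - b ν| ≤ R) ∧
          ∀ ν, |e.1 ν + (if ν = e.2 then 1 else 0) - b ν| ≤ R})ᶜ := by
  rintro _ ⟨e, ⟨he1, -⟩, rfl⟩ ⟨e', ⟨he'1, -⟩, heq⟩
  obtain ⟨μ, hμ1, hμ2⟩ := hsep
  have h' : (e'.1 μ : ZMod (2 * S + 1)) = (e.1 μ : ZMod (2 * S + 1)) := by
    have := congrArg (fun p : Edge 4 (2 * S + 1) => p.1 μ) heq
    simpa [torusEdge] using this
  rw [ZMod.intCast_eq_intCast_iff_dvd_sub] at h'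
  have h1 := abs_le.1 (he1 μ)
  have h2 := abs_le.1 (he'1 μ)
  have h3 := abs_le.1 hμ2
  push_cast at h1 h'
  have hne : e.1 μ - e'.1 μ ≠ 0 := by
    intro h0
    rcases lt_abs.1 hμ1 with h | h <;> omega
  refine hne (Int.eq_zero_of_abs_lt_dvd h' (abs_lt.2 ⟨?_, ?_⟩)) <;> omega

end Geometry

/-! ### The centred plaquette on the torus: locality, measurability, boundedness -/

section Plaquette

variable {G : Type*} [Group G] {N : ℕ} (ρ : G →* Matrix (Fin N) (Fin N) ℂ)

/-- **Locality of the plaquette observable on the torus**: `U ↦ Re tr ρ(U_p) − a`, `p` the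
plaquette of `ℤ⁴` at `c` in the plane `(i, j)` read through the periodic lift `torusLift L`,
depends only on the torus links in the image of the link cube `Q_M(c)`, `1 ≤ M` — its four
links have both endpoints within `ℓ^∞` distance `1` of `c` (a degenerate plaquette `i = j` is
constant) (Chatterjee arXiv:1803.01950 §3, definition of `U_p`). [folklore] -/
theorem dependsOn_plaquetteObs_torusLift_sub (L : ℕ) {M : ℕ} (hM : 1 ≤ M)
    (c : Literature.Probability.LatticeModels.Site 4) (i j : Fin 4) (a : ℝ) :
    DependsOn (fun U : GaugeConfig 4 L G => plaquetteObs ρ c i j (torusLift L U) - a)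
      (torusEdge L ''
        {e : ZdEdge 4 |
          (∀ ν, |e.1 ν - c ν| ≤ (M : ℤ)) ∧
          ∀ ν, |e.1 ν + (if ν = e.2 then 1 else 0) - c ν| ≤ (M : ℤ)}) := by
  intro U U' h
  have hT1 : ∀ (b : Literature.Probability.LatticeModels.Site 4) (k : Fin 4),
      (∀ ν, |b ν - c ν| ≤ (M : ℤ)) →
      (∀ ν, |(b + Pi.single k 1 : Literature.Probability.LatticeModels.Site 4) ν - c ν| ≤ (M : ℤ)) →
      U (torusEdge L (b, k)) = U' (torusEdge L (b, k)) := by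
    intro b k h1 h2
    refine h _ (Set.mem_image_of_mem _ ⟨h1, fun ν => ?_⟩)
    simpa [Pi.single_apply] using h2 ν
  have near : ∀ (v : Literature.Probability.LatticeModels.Site 4), (∀ ν, |v ν - c ν| ≤ 1) →
      ∀ ν, |v ν - c ν| ≤ (M : ℤ) :=
    fun v hv ν => (hv ν).trans (by exact_mod_cast hM)
  have h0 : ∀ ν, |c ν - c ν| ≤ (1 : ℤ) := fun ν => by simp
  have h1 : ∀ (k : Fin 4) (ν : Fin 4),
      |(c + Pi.single k 1 : Literature.Probability.LatticeModels.Site 4) ν - c ν| ≤ (1 : ℤ) := by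
    intro k ν
    by_cases hk : ν = k <;> simp [hk]
  simp only [plaquetteObs, plaquetteHolonomyZd, torusLift, Function.comp_apply]
  by_cases hij : i = j
  · subst hij
    simp
  · have h2 : ∀ ν,
        |(c + Pi.single i 1 + Pi.single j 1 : Literature.Probability.LatticeModels.Site 4) ν - c ν| ≤
          (1 : ℤ) := by
      intro ν
      by_cases hi : ν = i
      · simp [hi, hij]
      · by_cases hj : ν = j
        · simp [hj, Ne.symm hij]
        · simp [hi, hj]
    have h2' : ∀ ν,
        |(c + Pi.single j 1 + Pi.single i 1 : Literature.Probability.LatticeModels.Site 4) ν - c ν| ≤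
          (1 : ℤ) :=
      fun ν => by rw [add_right_comm]; exact h2 ν
    rw [hT1 c i (near _ h0) (near _ (h1 i)), hT1 _ j (near _ (h1 i)) (near _ h2),
      hT1 _ i (near _ (h1 j)) (near _ h2'), hT1 c j (near _ h0) (near _ (h1 j))]

/-- **Boundedness of the centred plaquette**: for unitary `ρ` and any probability measure `μ`
on torus configurations, `|Re tr ρ(U_p) − ∫ Re tr ρ(U_p) dμ| ≤ 2N` (`|Re tr ρ(U_p)| ≤ N`,
Chatterjee arXiv:1803.01950 §2–3). [folklore] -/
theorem abs_plaquetteObs_torusLift_sub_integral_le [TopologicalSpace G] [MeasurableSpace G]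
    (hρu : ∀ g, ρ g ∈ Matrix.unitaryGroup (Fin N) ℂ) (L : ℕ)
    (c : Literature.Probability.LatticeModels.Site 4) (i j : Fin 4)
    (μ : Measure (GaugeConfig 4 L G)) [IsProbabilityMeasure μ] (U : GaugeConfig 4 L G) :
    |plaquetteObs ρ c i j (torusLift L U) - ∫ V, plaquetteObs ρ c i j (torusLift L V) ∂μ| ≤
      2 * N := by
  have hb : ∀ V : GaugeConfig 4 L G, |plaquetteObs ρ c i j (torusLift L V)| ≤ N := fun V =>
    abs_plaquetteObs_le_holds (ρ := ρ) hρu c i j _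
  have hint : |∫ V, plaquetteObs ρ c i j (torusLift L V) ∂μ| ≤ N := by
    refine (abs_integral_le_integral_abs).trans ?_
    calc ∫ V, |plaquetteObs ρ c i j (torusLift L V)| ∂μ ≤ ∫ _, (N : ℝ) ∂μ :=
          integral_mono_of_nonneg (Eventually.of_forall fun _ => abs_nonneg _) (integrable_const _)
            (Eventually.of_forall hb)
      _ = N := by simp
  calc |plaquetteObs ρ c i j (torusLift L U) - ∫ V, plaquetteObs ρ c i j (torusLift L V) ∂μ|
      ≤ |plaquetteObs ρ c i j (torusLift L U)| +
          |∫ V, plaquetteObs ρ c i j (torusLift L V) ∂μ| := abs_sub _ _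
    _ ≤ N + N := add_le_add (hb U) hint
    _ = 2 * N := by ring

variable [TopologicalSpace G] [IsTopologicalGroup G] [MeasurableSpace G] [BorelSpace G]
  [SecondCountableTopology G]

/-- **Cylinder measurability of the plaquette observable on the torus**: for a continuous
representation, `U ↦ Re tr ρ(U_p) − a` read through the periodic lift is (strongly) measurable
for the cylinder σ-algebra of the torus links in the image of the link cube `Q_M(c)`, `1 ≤ M`
(a measurable local function is `𝓕_Δ`-measurable, Georgii 2011, §1.2). [folklore] -/
theorem stronglyMeasurable_plaquetteObs_torusLift_sub (hρ : Continuous ρ) (L : ℕ) {M : ℕ}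
    (hM : 1 ≤ M) (c : Literature.Probability.LatticeModels.Site 4) (i j : Fin 4) (a : ℝ) :
    StronglyMeasurable[(cylinderEvents (torusEdge L ''
        {e : ZdEdge 4 |
          (∀ ν, |e.1 ν - c ν| ≤ (M : ℤ)) ∧
          ∀ ν, |e.1 ν + (if ν = e.2 then 1 else 0) - c ν| ≤ (M : ℤ)}) :
        MeasurableSpace (GaugeConfig 4 L G))]
      (fun U : GaugeConfig 4 L G => plaquetteObs ρ c i j (torusLift L U) - a) :=
  ((((measurable_plaquetteObs ρ hρ c i j).comp (measurable_torusLift L)).sub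
    measurable_const).measurable_cylinderEvents_of_dependsOn
      (dependsOn_plaquetteObs_torusLift_sub ρ L hM c i j a)).stronglyMeasurable

/-- **The centred plaquette is in every `Lᵖ`** of a probability measure on torus configurations
(continuous unitary `ρ`: measurable and bounded by `2N`). [folklore] -/
theorem memLp_plaquetteObs_torusLift_sub_integral (hρ : Continuous ρ)
    (hρu : ∀ g, ρ g ∈ Matrix.unitaryGroup (Fin N) ℂ) (L : ℕ)
    (c : Literature.Probability.LatticeModels.Site 4) (i j : Fin 4)
    (μ : Measure (GaugeConfig 4 L G)) [IsProbabilityMeasure μ] (p : ℝ≥0∞) :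
    MemLp (fun U => plaquetteObs ρ c i j (torusLift L U) -
      ∫ V, plaquetteObs ρ c i j (torusLift L V) ∂μ) p μ :=
  MemLp.of_bound (((measurable_plaquetteObs ρ hρ c i j).comp
    (measurable_torusLift L)).sub measurable_const).aestronglyMeasurable (2 * N)
    (Eventually.of_forall fun U => by
      rw [Real.norm_eq_abs]; exact abs_plaquetteObs_torusLift_sub_integral_le ρ hρu L c i j μ U)

end Plaquette

end Literature.MathematicalPhysics.QuantumLattice
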